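import Summits.Ventures.CertifiedManyBodySolver.Downfold.BoxesLa214
import HarnessLib

/-!
# The confidence class of a word read through a typed box: weakest link over the entries the word READS

Venture CertifiedManyBodySolver, cell `pub/hubbard-downfold` (stage S1 ↔ the phase-map schema), seat
hubbard-downfold-mod-1; namespace `Summit.Ventures.CertifiedManyBodySolver.Downfold`. The oracle's phase map
(D-0098/D-0099) prints one confidence class per cell — `certified` | `screening-grade` | `extrapolated` —
and the cell's README line 3 says what this stage is NOT: «S1 is SYSTEMATIC; its output is a parameter BOX
… never a certified statement». `ParameterBox.lean` (p456420) typed the three classes as `Grade` with the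
weakest-link combination `Grade.weakest`. This file is the word-level bookkeeping, PROVED:

* `Grade.weakestList` — the weakest link of a list of grades (`certified` is the unit);
  `weakestList_eq_certified_iff` (certified iff every member is), `rank_weakestList_le` (never above a
  member), `weakestList_cons`.
* `Box.gradeOn B l` — the grade of a box ON the coordinates `l` a word reads: the weakest grade of the
  entries present there (an absent coordinate contributes nothing — a word that reads it cannot be stated
  on the box at all).
* `seamClass s2 B l := s2.weakest (B.gradeOn l)` — THE CLASS OF A WORD OBTAINED THROUGH THE SEAM: an S2
  statement of class `s2` attached to box `B` through entries `l` (e.g. `holdsOn_of_forall_s2Box` reads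
  `U/t, tp/t, n`; the `t''` seam reads `tpp/t` too). `seamClass_eq_certified_iff`: certified iff the S2
  statement is certified AND every entry read is certified-grade; `seamClass_le_s2` / `seamClass_le_box`
  (the class never exceeds either input).
* Instances on the boxes of record (BoxesLa214, p478802): `boxLa214E_M15_gradeOn_s2 = screening`,
  hence **`seamClass certified boxLa214E_M15 [U/t, tp/t, n] = screening`** — a CERTIFIED S2 energy
  window read through the La-214 box of record is a SCREENING-GRADE material statement, by theorem
  (`boxLa214E_M15_seamClass`), and likewise `boxLa214M_M15` through `[U/t, tp/t, tpp/t, n]`.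

HONEST FRAMING: bookkeeping only — the grades are the writers' declared provenance classes, typed
verbatim; nothing here upgrades or certifies any number.
-/

namespace Summit.Ventures.CertifiedManyBodySolver.Downfold

namespace Grade

/-- The rank of any grade is at most `2` (`certified`). [folklore] -/
theorem rank_le_two (g : Grade) : g.rank ≤ 2 := by
  cases g <;> decide

/-- `certified` has the top rank. [folklore] -/
@[simp] theorem rank_certified : certified.rank = 2 := rfl

/-- A grade is `certified` iff its rank is `2`. [folklore] -/
theorem eq_certified_iff_rank (g : Grade) : g = certified ↔ g.rank = 2 := by
  cases g <;> decide

/-- `certified` is a left unit of the weakest-link combination. [folklore] -/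
@[simp] theorem certified_weakest (g : Grade) : certified.weakest g = g :=
  rank_injective (by rw [rank_weakest, rank_certified, min_eq_right (rank_le_two g)])

/-- `certified` is a right unit of the weakest-link combination. [folklore] -/
@[simp] theorem weakest_certified (g : Grade) : g.weakest certified = g := by
  rw [weakest_comm, certified_weakest]

/-- The weakest-link combination is below its left argument (in rank). [folklore] -/
theorem rank_weakest_le_left (g h : Grade) : (g.weakest h).rank ≤ g.rank := by
  rw [rank_weakest]; exact min_le_left _ _

/-- The weakest-link combination is below its right argument (in rank). [folklore] -/
theorem rank_weakest_le_right (g h : Grade) : (g.weakest h).rank ≤ h.rank := by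
  rw [rank_weakest]; exact min_le_right _ _

/-- **Weakest link of a list of grades** (`certified` for the empty list: reading nothing costs nothing).
[folklore] -/
def weakestList : List Grade → Grade
  | [] => certified
  | g :: l => g.weakest (weakestList l)

/-- Unfolding on a cons. [folklore] -/
@[simp] theorem weakestList_cons (g : Grade) (l : List Grade) :
    weakestList (g :: l) = g.weakest (weakestList l) := rfl

/-- The empty read is `certified`. [folklore] -/
@[simp] theorem weakestList_nil : weakestList [] = certified := rfl

/-- **Certified iff every member is certified.** [folklore] -/
theorem weakestList_eq_certified_iff (l : List Grade) :
    weakestList l = certified ↔ ∀ g ∈ l, g = certified := by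
  induction l with
  | nil => simp
  | cons g l ih => simp [weakestList_cons, weakest_eq_certified_iff, ih]

/-- The weakest link of a list is never above any member (in rank). [folklore] -/
theorem rank_weakestList_le {l : List Grade} {g : Grade} (hg : g ∈ l) : (weakestList l).rank ≤ g.rank := by
  induction l with
  | nil => simp at hg
  | cons h l ih =>
    rw [weakestList_cons]
    rcases List.mem_cons.1 hg with rfl | hg'
    · exact rank_weakest_le_left _ _
    · exact (rank_weakest_le_right _ _).trans (ih hg')

end Grade

/-! ### The grade of a box on the coordinates a word reads -/

/-- The grades of the entries of `B` present on the coordinate list `l` (absent coordinates skipped).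
[folklore] -/
def Box.gradesOn {ι : Type*} (B : Box ι) (l : List ι) : List Grade :=
  (l.filterMap B).map Entry.grade

/-- **The grade of a box ON the coordinates `l`**: weakest link over the entries present there. [folklore] -/
def Box.gradeOn {ι : Type*} (B : Box ι) (l : List ι) : Grade :=
  Grade.weakestList (B.gradesOn l)

/-- A box is certified-grade on `l` iff every entry present on `l` is certified. [folklore] -/
theorem Box.gradeOn_eq_certified_iff {ι : Type*} (B : Box ι) (l : List ι) :
    B.gradeOn l = .certified ↔ ∀ i ∈ l, ∀ e, B i = some e → e.grade = .certified := by
  unfold Box.gradeOn Box.gradesOn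
  rw [Grade.weakestList_eq_certified_iff]
  constructor
  · intro h i hi e he
    exact h e.grade (List.mem_map.2 ⟨e, List.mem_filterMap.2 ⟨i, hi, he⟩, rfl⟩)
  · intro h g hg
    obtain ⟨e, he, rfl⟩ := List.mem_map.1 hg
    obtain ⟨i, hi, hie⟩ := List.mem_filterMap.1 he
    exact h i hi e hie

/-! ### The class of a word obtained through the seam -/

/-- **The class of a word read through the seam**: an S2 statement of class `s2` attached to the box `B`
through the entries on `l` carries the weakest of `s2` and the box's grade on `l`. [folklore] -/
def seamClass {ι : Type*} (s2 : Grade) (B : Box ι) (l : List ι) : Grade :=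
  s2.weakest (B.gradeOn l)

/-- **Certified iff both the S2 statement and every entry read are certified.** [folklore] -/
theorem seamClass_eq_certified_iff {ι : Type*} (s2 : Grade) (B : Box ι) (l : List ι) :
    seamClass s2 B l = .certified ↔
      s2 = .certified ∧ ∀ i ∈ l, ∀ e, B i = some e → e.grade = .certified := by
  unfold seamClass
  rw [Grade.weakest_eq_certified_iff, Box.gradeOn_eq_certified_iff]

/-- The class of a seam word never exceeds the class of the S2 statement. [folklore] -/
theorem rank_seamClass_le_s2 {ι : Type*} (s2 : Grade) (B : Box ι) (l : List ι) :
    (seamClass s2 B l).rank ≤ s2.rank :=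
  Grade.rank_weakest_le_left _ _

/-- The class of a seam word never exceeds the box's grade on the entries read. [folklore] -/
theorem rank_seamClass_le_box {ι : Type*} (s2 : Grade) (B : Box ι) (l : List ι) :
    (seamClass s2 B l).rank ≤ (B.gradeOn l).rank :=
  Grade.rank_weakest_le_right _ _

/-- **A screening-grade entry read caps the word at screening grade**: if some coordinate read carries a
`screening` entry, a word through the seam is never certified. [folklore] -/
theorem seamClass_ne_certified_of_screening {ι : Type*} (s2 : Grade) (B : Box ι) (l : List ι) {i : ι}
    (hi : i ∈ l) {e : Entry} (he : B i = some e) (hg : e.grade = .screening) :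
    seamClass s2 B l ≠ .certified := by
  intro h
  have := ((seamClass_eq_certified_iff s2 B l).1 h).2 i hi e he
  rw [hg] at this
  exact absurd this (by decide)

/-! ### The La-214 boxes of record (BoxesLa214): a certified S2 word read through them is screening-grade -/

/-- The La-214 M15 object-E box is screening-grade on the seam's coordinates `U/t, tp/t, n`. [folklore] -/
theorem boxLa214E_M15_gradeOn_s2 :
    boxLa214E_M15.gradeOn [.UOverT, .tpOverT, .filling] = .screening := by
  decide

/-- **A CERTIFIED S2 energy window read through the La-214 M15 box of record (object E) is a SCREENING-GRADE
material statement** — the cell's «systematic, not certified» line as a theorem. [folklore] -/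
theorem boxLa214E_M15_seamClass :
    seamClass .certified boxLa214E_M15 [.UOverT, .tpOverT, .filling] = .screening := by
  decide

/-- The La-214 M15 object-M box is screening-grade on the `t''` seam's coordinates `U/t, tp/t, tpp/t, n`.
[folklore] -/
theorem boxLa214M_M15_gradeOn_tpp :
    boxLa214M_M15.gradeOn [.UOverT, .tpOverT, .tppOverT, .filling] = .screening := by
  decide

/-- **The object-M energy word through the `t''` seam on the La-214 M15 box is SCREENING-GRADE** even from a
certified S2 window and the kinematic constant (a kernel theorem). [folklore] -/
theorem boxLa214M_M15_seamClass :
    seamClass .certified boxLa214M_M15 [.UOverT, .tpOverT, .tppOverT, .filling] = .screening := by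
  decide

/-- An `extrapolated` S2 input (e.g. a word beyond the certified cells) makes any seam word extrapolated,
whatever the box. [folklore] -/
theorem seamClass_extrapolated {ι : Type*} (B : Box ι) (l : List ι) :
    seamClass .extrapolated B l = .extrapolated := by
  unfold seamClass Grade.weakest
  simp [Grade.rank]

end Summit.Ventures.CertifiedManyBodySolver.Downfold
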